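import Summits.CriticalPhenomena.PercolationContinuityZ3.Theorems.PercNearOneGluingNoHeavyLowerTailAnchoredRegimeI
import Summits.CriticalPhenomena.PercolationContinuityZ3.Theorems.PercNearOneGluingNoHeavyLowerTailKernelTwoPlusStarRegimeIExchange
import HarnessLib

/-!
# `NoHeavyLowerTail` (stmt-CriticalPhenomena-4575) — the `2 + star` kernel at the observer level, regime I FULLY ANCHORED, and regimes I ∪ II merged
# (no ranking of the witness against the pair)

Support file (prover `prim-cplus-coupling`, gen 17, for the lemma factory `prim-lf-3`; `--supports stmt-CriticalPhenomena-4575`).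
No definitions, no named facts, no sorries.  Companion of `…AnchoredRegimeI` (face level); memos
`run/shared/lean/prim/prim-cplus-coupling/A5-COUPLING-gen17.md`, `run/shared/lean/prim/prim-lf-3/LF3-BETA-R.md` §19.

Object (as `kernel_twoPlusStar_regimeI_of_exchange` / `kernel_twoPlusStar_regimeII_anchored`): one-layer observer `o` with ports `{p₁, p₂} ∪ Q`
(`|Q|` arbitrary, product law on `Q`, hairs of `p₁, p₂` in `(0,1)`), core `K` (`o` isolated), `u = h₁h₂`, `K_u = (1−u)K + uK[p₁p₂↦1]`, witness
`j`, target `b`; inputs = the SPLIT ROWS of `p₁`, `p₂` and of one `Q`-port `q` that is below `j` and below every `Q`-port in `K_u`; `p₁` the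
`K`-weaker port (`hle`).  Conclusion: Kozma–Nitzan's (41), `μ_W(j ↔ b, o ↔ A) ≤ μ_W(o ↔ b)`.

* `kernel_twoPlusStar_regimeI_anchored` — regime I (`j ≤ p₁` in `K_u`, `hjcu`) with NO per-atom hypothesis: every atom's exchange inequality,
  hard core included, is `exchangeI_of_unglued_ranking` (the quantitative glued Question 9 `ClubPsi.clubEvent` transported to `K_u/Y`);
* `kernel_twoPlusStar_portRow_anchored` — regimes I ∪ II together (`le_total` on the `K_u`-reliabilities of `j` and `p₁`;
  regime II is `kernel_twoPlusStar_regimeII_anchored`, lf-3 gen 15, from `HullPort.kn_question9_three`): hypotheses `hle`, `hqj`, `hqmin` and the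
  three rows only.
Together with `kernel_twoPlusStar_regimeB/C/D` (lf-3 gen 7/11) every row of the `2 + m` kernel table (memo LF3-BETA-R §19) is now free of per-atom
hypotheses.
[cite: KozmaNitzan2024, Question 9 (p. 36), Question 7 (p. 36), (41) (p. 36), Thm. 4–5 and Lemma 5 (pp. 12–14), (9) (pp. 9–10)]
-/

namespace Summit.CriticalPhenomena.PercolationContinuityZ3.Theorems

open MeasureTheory Set ProbabilityTheory
open Literature.Probability.LatticeModels
open Literature.Probability.Percolation

noncomputable section
open Classical

namespace UpsetExchange

variable {n : ℕ}

/-- **The `2 + star` kernel in regime I, observer level, fully anchored**: Kozma–Nitzan's (41) for a one-layer observer with ports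
`{p₁, p₂} ∪ Q` from the split rows of `p₁`, `p₂`, `q`, under rankings in `K` and `K_u` only (`p₁` the `K`-weaker port, the witness `j` at most
as connected as `p₁` in `K_u`, `q` below `j` and below every `Q`-port in `K_u`) — the hard-core atoms are supplied by `ClubPsi.clubEvent`.
[cite: KozmaNitzan2024, Question 9 (p. 36), Question 7 (p. 36), Thm. 4–5 and Lemma 5 (pp. 12–14)] -/
theorem kernel_twoPlusStar_regimeI_anchored (W : Sym2 (Fin n) → unitInterval) (A Q : Finset (Fin n)) (o p₁ p₂ q j b : Fin n)
    (K : Sym2 (Fin n) → unitInterval) (hK : K = fun e => if o ∈ e then 0 else W e)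
    (u : unitInterval) (hu : (u : ℝ) = (W s(o, p₁) : ℝ) * W s(o, p₂))
    (ν : Finset (Fin n) → ℝ) (hν : ∀ Y : Finset (Fin n), ν Y = (∏ q ∈ Y, (W s(o, q) : ℝ)) * ∏ q ∈ Q \ Y, (1 - (W s(o, q) : ℝ)))
    (G : Finset (Fin n) → ℝ)
    (hG : ∀ T : Finset (Fin n), G T =
      (prodBernoulli (fun f : Sym2 (Fin n) => if f ∈ T.image (fun t => s(o, t)) then 1 else K f)).real (openConn o b) -
        (prodBernoulli (fun f : Sym2 (Fin n) => if f ∈ T.image (fun t => s(o, t)) then 1 else K f)).real (openConn j b))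
    (hoA : o ∉ A) (hp₁A : p₁ ∈ A) (hp₂A : p₂ ∈ A) (hQA : Q ⊆ A) (hp₁Q : p₁ ∉ Q) (hp₂Q : p₂ ∉ Q) (hbQ : b ∉ Q) (hp : p₁ ≠ p₂)
    (hjo : j ≠ o) (hbo : b ≠ o)
    (hiso : ∀ u' : Fin n, u' ≠ o → u' ∉ insert p₁ (insert p₂ Q) → W s(o, u') = 0) (hloop : W s(o, o) = 0)
    (hh₁ : 0 < (W s(o, p₁) : ℝ)) (hh₁' : (W s(o, p₁) : ℝ) < 1) (hh₂ : 0 < (W s(o, p₂) : ℝ)) (hh₂' : (W s(o, p₂) : ℝ) < 1)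
    (hle : (prodBernoulli K).real (openConn p₁ b) ≤ (prodBernoulli K).real (openConn p₂ b))
    (hjb : j ≠ b) (hp₁j : p₁ ≠ j) (hp₂j : p₂ ≠ j) (hjQ : j ∉ Q) (hbA : b ∉ A)
    (hjcu : (1 - (u : ℝ)) * (prodBernoulli K).real (openConn j b) +
        (u : ℝ) * (prodBernoulli (fun f : Sym2 (Fin n) => if f = s(p₁, p₂) then 1 else K f)).real (openConn j b) ≤
      (1 - (u : ℝ)) * (prodBernoulli K).real (openConn p₁ b) +
        (u : ℝ) * (prodBernoulli (fun f : Sym2 (Fin n) => if f = s(p₁, p₂) then 1 else K f)).real (openConn p₁ b))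
    (hqj : (1 - (u : ℝ)) * (prodBernoulli K).real (openConn q b) +
        (u : ℝ) * (prodBernoulli (fun f : Sym2 (Fin n) => if f = s(p₁, p₂) then 1 else K f)).real (openConn q b) ≤
      (1 - (u : ℝ)) * (prodBernoulli K).real (openConn j b) +
        (u : ℝ) * (prodBernoulli (fun f : Sym2 (Fin n) => if f = s(p₁, p₂) then 1 else K f)).real (openConn j b))
    (hqmin : ∀ y ∈ Q, (1 - (u : ℝ)) * (prodBernoulli K).real (openConn q b) +
        (u : ℝ) * (prodBernoulli (fun f : Sym2 (Fin n) => if f = s(p₁, p₂) then 1 else K f)).real (openConn q b) ≤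
      (1 - (u : ℝ)) * (prodBernoulli K).real (openConn y b) +
        (u : ℝ) * (prodBernoulli (fun f : Sym2 (Fin n) => if f = s(p₁, p₂) then 1 else K f)).real (openConn y b))
    (hrow₁ : 0 ≤ ∑ S ∈ Q.powerset, ν S *
      ((1 - (u : ℝ)) * ((prodBernoulli (fun e : Sym2 (Fin n) => if (∀ x ∈ e, x ∈ S) ∧ ¬ e.IsDiag then 1 else K e)).real (openConn p₁ b) -
          (prodBernoulli (fun e : Sym2 (Fin n) => if (∀ x ∈ e, x ∈ S) ∧ ¬ e.IsDiag then 1 else K e)).real (openConn j b)) +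
        (u : ℝ) * ((prodBernoulli (fun f : Sym2 (Fin n) => if f = s(p₁, p₂) then 1 else
              (if (∀ x ∈ f, x ∈ S) ∧ ¬ f.IsDiag then 1 else K f))).real (openConn p₁ b) -
          (prodBernoulli (fun f : Sym2 (Fin n) => if f = s(p₁, p₂) then 1 else
              (if (∀ x ∈ f, x ∈ S) ∧ ¬ f.IsDiag then 1 else K f))).real (openConn j b))))
    (hrow₂ : 0 ≤ ∑ S ∈ Q.powerset, ν S *
      ((1 - (u : ℝ)) * ((prodBernoulli (fun e : Sym2 (Fin n) => if (∀ x ∈ e, x ∈ S) ∧ ¬ e.IsDiag then 1 else K e)).real (openConn p₂ b) -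
          (prodBernoulli (fun e : Sym2 (Fin n) => if (∀ x ∈ e, x ∈ S) ∧ ¬ e.IsDiag then 1 else K e)).real (openConn j b)) +
        (u : ℝ) * ((prodBernoulli (fun f : Sym2 (Fin n) => if f = s(p₂, p₁) then 1 else
              (if (∀ x ∈ f, x ∈ S) ∧ ¬ f.IsDiag then 1 else K f))).real (openConn p₂ b) -
          (prodBernoulli (fun f : Sym2 (Fin n) => if f = s(p₂, p₁) then 1 else
              (if (∀ x ∈ f, x ∈ S) ∧ ¬ f.IsDiag then 1 else K f))).real (openConn j b))))
    (hrowq : 0 ≤ ∑ S ∈ Q.powerset, ν S *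
      ((1 - (u : ℝ)) * ((prodBernoulli (fun e : Sym2 (Fin n) => if (∀ x ∈ e, x ∈ S) ∧ ¬ e.IsDiag then 1 else K e)).real (openConn q b) -
          (prodBernoulli (fun e : Sym2 (Fin n) => if (∀ x ∈ e, x ∈ S) ∧ ¬ e.IsDiag then 1 else K e)).real (openConn j b)) +
        (u : ℝ) * ((prodBernoulli (fun f : Sym2 (Fin n) => if f = s(p₁, p₂) then 1 else
              (if (∀ x ∈ f, x ∈ S) ∧ ¬ f.IsDiag then 1 else K f))).real (openConn q b) -
          (prodBernoulli (fun f : Sym2 (Fin n) => if f = s(p₁, p₂) then 1 else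
              (if (∀ x ∈ f, x ∈ S) ∧ ¬ f.IsDiag then 1 else K f))).real (openConn j b)))) :
    (prodBernoulli W).real (openConn j b ∩ ⋃ a ∈ A, openConn o a) ≤ (prodBernoulli W).real (openConn o b) := by
  have hp₁b : p₁ ≠ b := fun h => hbA (h ▸ hp₁A)
  have hp₂b : p₂ ≠ b := fun h => hbA (h ▸ hp₂A)
  have hsure := real_openConn_eq_of_surePair K p₁ p₂ b hp
  have hu1' : 0 ≤ 1 - (u : ℝ) := sub_nonneg.2 (unitInterval.le_one u)
  have hcdu : (1 - (u : ℝ)) * (prodBernoulli K).real (openConn p₁ b) +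
        (u : ℝ) * (prodBernoulli (fun f : Sym2 (Fin n) => if f = s(p₁, p₂) then 1 else K f)).real (openConn p₁ b) ≤
      (1 - (u : ℝ)) * (prodBernoulli K).real (openConn p₂ b) +
        (u : ℝ) * (prodBernoulli (fun f : Sym2 (Fin n) => if f = s(p₁, p₂) then 1 else K f)).real (openConn p₂ b) := by
    rw [hsure]
    nlinarith [mul_le_mul_of_nonneg_left hle hu1']
  have hjdu := hjcu.trans hcdu
  exact kernel_twoPlusStar_regimeI_of_exchange W A Q o p₁ p₂ q j b K hK u hu ν hν G hG hoA hp₁A hp₂A hQA hp₁Q hp₂Q hbQ hp hjo hbo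
    hiso hloop hh₁ hh₁' hh₂ hh₂' hle hp₁j hp₂j hjQ hbA hjcu
    (fun Y hY _ s₀ hs₀ =>
      exchangeI_of_unglued_ranking K Y p₁ p₂ j b s₀ u hs₀ (fun h => hbQ (Finset.mem_powerset.1 hY h))
        (fun h => hp₁Q (Finset.mem_powerset.1 hY h)) hp₁b hp₂b hjb hp hp₁j hp₂j hjcu hjdu)
    hqj hqmin hrow₁ hrow₂ hrowq

/-- **The `2 + star` kernel with a port row, observer level, regimes I ∪ II** (no ranking of the witness against the pair): one-layer observer `o`
with ports `{p₁, p₂} ∪ Q` (product law on `Q`, hairs of `p₁, p₂` in `(0,1)`), `p₁` the `K`-weaker port, some `Q`-port `q` below `j` and below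
every `Q`-port in `K_u`; the split rows of `p₁`, `p₂`, `q` give Kozma–Nitzan's (41) `μ_W(j ↔ b, o ↔ A) ≤ μ_W(o ↔ b)`.
(`kernel_twoPlusStar_regimeI_anchored` if `j ≤ p₁` in `K_u`, `kernel_twoPlusStar_regimeII_anchored` if `p₁ ≤ j`.)
[cite: KozmaNitzan2024, Question 9 (p. 36), Question 7 (p. 36), Thm. 4–5 and Lemma 5 (pp. 12–14)] -/
theorem kernel_twoPlusStar_portRow_anchored (W : Sym2 (Fin n) → unitInterval) (A Q : Finset (Fin n)) (o p₁ p₂ q j b : Fin n)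
    (K : Sym2 (Fin n) → unitInterval) (hK : K = fun e => if o ∈ e then 0 else W e)
    (u : unitInterval) (hu : (u : ℝ) = (W s(o, p₁) : ℝ) * W s(o, p₂))
    (ν : Finset (Fin n) → ℝ) (hν : ∀ Y : Finset (Fin n), ν Y = (∏ q ∈ Y, (W s(o, q) : ℝ)) * ∏ q ∈ Q \ Y, (1 - (W s(o, q) : ℝ)))
    (G : Finset (Fin n) → ℝ)
    (hG : ∀ T : Finset (Fin n), G T =
      (prodBernoulli (fun f : Sym2 (Fin n) => if f ∈ T.image (fun t => s(o, t)) then 1 else K f)).real (openConn o b) -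
        (prodBernoulli (fun f : Sym2 (Fin n) => if f ∈ T.image (fun t => s(o, t)) then 1 else K f)).real (openConn j b))
    (hoA : o ∉ A) (hp₁A : p₁ ∈ A) (hp₂A : p₂ ∈ A) (hQA : Q ⊆ A) (hp₁Q : p₁ ∉ Q) (hp₂Q : p₂ ∉ Q) (hbQ : b ∉ Q) (hp : p₁ ≠ p₂)
    (hjo : j ≠ o) (hbo : b ≠ o)
    (hiso : ∀ u' : Fin n, u' ≠ o → u' ∉ insert p₁ (insert p₂ Q) → W s(o, u') = 0) (hloop : W s(o, o) = 0)
    (hh₁ : 0 < (W s(o, p₁) : ℝ)) (hh₁' : (W s(o, p₁) : ℝ) < 1) (hh₂ : 0 < (W s(o, p₂) : ℝ)) (hh₂' : (W s(o, p₂) : ℝ) < 1)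
    (hle : (prodBernoulli K).real (openConn p₁ b) ≤ (prodBernoulli K).real (openConn p₂ b))
    (hjb : j ≠ b) (hp₁j : p₁ ≠ j) (hp₂j : p₂ ≠ j) (hjQ : j ∉ Q) (hbA : b ∉ A)
    (hqj : (1 - (u : ℝ)) * (prodBernoulli K).real (openConn q b) +
        (u : ℝ) * (prodBernoulli (fun f : Sym2 (Fin n) => if f = s(p₁, p₂) then 1 else K f)).real (openConn q b) ≤
      (1 - (u : ℝ)) * (prodBernoulli K).real (openConn j b) +
        (u : ℝ) * (prodBernoulli (fun f : Sym2 (Fin n) => if f = s(p₁, p₂) then 1 else K f)).real (openConn j b))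
    (hqmin : ∀ y ∈ Q, (1 - (u : ℝ)) * (prodBernoulli K).real (openConn q b) +
        (u : ℝ) * (prodBernoulli (fun f : Sym2 (Fin n) => if f = s(p₁, p₂) then 1 else K f)).real (openConn q b) ≤
      (1 - (u : ℝ)) * (prodBernoulli K).real (openConn y b) +
        (u : ℝ) * (prodBernoulli (fun f : Sym2 (Fin n) => if f = s(p₁, p₂) then 1 else K f)).real (openConn y b))
    (hrow₁ : 0 ≤ ∑ S ∈ Q.powerset, ν S *
      ((1 - (u : ℝ)) * ((prodBernoulli (fun e : Sym2 (Fin n) => if (∀ x ∈ e, x ∈ S) ∧ ¬ e.IsDiag then 1 else K e)).real (openConn p₁ b) -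
          (prodBernoulli (fun e : Sym2 (Fin n) => if (∀ x ∈ e, x ∈ S) ∧ ¬ e.IsDiag then 1 else K e)).real (openConn j b)) +
        (u : ℝ) * ((prodBernoulli (fun f : Sym2 (Fin n) => if f = s(p₁, p₂) then 1 else
              (if (∀ x ∈ f, x ∈ S) ∧ ¬ f.IsDiag then 1 else K f))).real (openConn p₁ b) -
          (prodBernoulli (fun f : Sym2 (Fin n) => if f = s(p₁, p₂) then 1 else
              (if (∀ x ∈ f, x ∈ S) ∧ ¬ f.IsDiag then 1 else K f))).real (openConn j b))))
    (hrow₂ : 0 ≤ ∑ S ∈ Q.powerset, ν S *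
      ((1 - (u : ℝ)) * ((prodBernoulli (fun e : Sym2 (Fin n) => if (∀ x ∈ e, x ∈ S) ∧ ¬ e.IsDiag then 1 else K e)).real (openConn p₂ b) -
          (prodBernoulli (fun e : Sym2 (Fin n) => if (∀ x ∈ e, x ∈ S) ∧ ¬ e.IsDiag then 1 else K e)).real (openConn j b)) +
        (u : ℝ) * ((prodBernoulli (fun f : Sym2 (Fin n) => if f = s(p₂, p₁) then 1 else
              (if (∀ x ∈ f, x ∈ S) ∧ ¬ f.IsDiag then 1 else K f))).real (openConn p₂ b) -
          (prodBernoulli (fun f : Sym2 (Fin n) => if f = s(p₂, p₁) then 1 else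
              (if (∀ x ∈ f, x ∈ S) ∧ ¬ f.IsDiag then 1 else K f))).real (openConn j b))))
    (hrowq : 0 ≤ ∑ S ∈ Q.powerset, ν S *
      ((1 - (u : ℝ)) * ((prodBernoulli (fun e : Sym2 (Fin n) => if (∀ x ∈ e, x ∈ S) ∧ ¬ e.IsDiag then 1 else K e)).real (openConn q b) -
          (prodBernoulli (fun e : Sym2 (Fin n) => if (∀ x ∈ e, x ∈ S) ∧ ¬ e.IsDiag then 1 else K e)).real (openConn j b)) +
        (u : ℝ) * ((prodBernoulli (fun f : Sym2 (Fin n) => if f = s(p₁, p₂) then 1 else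
              (if (∀ x ∈ f, x ∈ S) ∧ ¬ f.IsDiag then 1 else K f))).real (openConn q b) -
          (prodBernoulli (fun f : Sym2 (Fin n) => if f = s(p₁, p₂) then 1 else
              (if (∀ x ∈ f, x ∈ S) ∧ ¬ f.IsDiag then 1 else K f))).real (openConn j b)))) :
    (prodBernoulli W).real (openConn j b ∩ ⋃ a ∈ A, openConn o a) ≤ (prodBernoulli W).real (openConn o b) := by
  rcases le_total ((1 - (u : ℝ)) * (prodBernoulli K).real (openConn j b) +
        (u : ℝ) * (prodBernoulli (fun f : Sym2 (Fin n) => if f = s(p₁, p₂) then 1 else K f)).real (openConn j b))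
      ((1 - (u : ℝ)) * (prodBernoulli K).real (openConn p₁ b) +
        (u : ℝ) * (prodBernoulli (fun f : Sym2 (Fin n) => if f = s(p₁, p₂) then 1 else K f)).real (openConn p₁ b)) with hjcu | hcju
  · exact kernel_twoPlusStar_regimeI_anchored W A Q o p₁ p₂ q j b K hK u hu ν hν G hG hoA hp₁A hp₂A hQA hp₁Q hp₂Q hbQ hp hjo hbo
      hiso hloop hh₁ hh₁' hh₂ hh₂' hle hjb hp₁j hp₂j hjQ hbA hjcu hqj hqmin hrow₁ hrow₂ hrowq
  · exact kernel_twoPlusStar_regimeII_anchored W A Q o p₁ p₂ q j b K hK u hu ν hν G hG hoA hp₁A hp₂A hQA hp₁Q hp₂Q hbQ hp hjo hbo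
      hiso hloop hh₁ hh₁' hh₂ hh₂' hle hjb hp₁j hp₂j hjQ hbA hcju hqj hqmin hrow₁ hrow₂ hrowq

/-- **The `2 + star` kernel, observer level, ONE THEOREM** (all regimes; `p₁` labelled as the `K`-weaker port): one-layer observer `o` with ports
`{p₁, p₂} ∪ Q` (product law on `Q`, hairs of `p₁, p₂` in `(0,1)`), core `K`, `K_u = (1−u)K + uK[p₁p₂↦1]`, witness `j ≠ b`, target `b ∉ A`.
Inputs: the split rows of `p₁` and `p₂`, and the split row of a `K_u`-weakest `Q`-port ONLY IF it is at most as `b`-reliable as `j` in `K_u`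
(`hrowQ`, guarded).  Conclusion: Kozma–Nitzan's (41), `μ_W(j ↔ b, o ↔ A) ≤ μ_W(o ↔ b)`.  (If some `Q`-port is below `j` in `K_u`, take the
`K_u`-weakest one in `kernel_twoPlusStar_portRow_anchored`; otherwise take `q := j` there — its row vanishes identically.)
[cite: KozmaNitzan2024, Question 9 (p. 36), Question 7 (p. 36), (41) (p. 36), Thm. 4–5 and Lemma 5 (pp. 12–14)] -/
theorem kernel_twoPlusStar_anchored_of_le (W : Sym2 (Fin n) → unitInterval) (A Q : Finset (Fin n)) (o p₁ p₂ j b : Fin n)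
    (K : Sym2 (Fin n) → unitInterval) (hK : K = fun e => if o ∈ e then 0 else W e)
    (u : unitInterval) (hu : (u : ℝ) = (W s(o, p₁) : ℝ) * W s(o, p₂))
    (ν : Finset (Fin n) → ℝ) (hν : ∀ Y : Finset (Fin n), ν Y = (∏ q ∈ Y, (W s(o, q) : ℝ)) * ∏ q ∈ Q \ Y, (1 - (W s(o, q) : ℝ)))
    (G : Finset (Fin n) → ℝ)
    (hG : ∀ T : Finset (Fin n), G T =
      (prodBernoulli (fun f : Sym2 (Fin n) => if f ∈ T.image (fun t => s(o, t)) then 1 else K f)).real (openConn o b) -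
        (prodBernoulli (fun f : Sym2 (Fin n) => if f ∈ T.image (fun t => s(o, t)) then 1 else K f)).real (openConn j b))
    (hoA : o ∉ A) (hp₁A : p₁ ∈ A) (hp₂A : p₂ ∈ A) (hQA : Q ⊆ A) (hp₁Q : p₁ ∉ Q) (hp₂Q : p₂ ∉ Q) (hbQ : b ∉ Q) (hp : p₁ ≠ p₂)
    (hjo : j ≠ o) (hbo : b ≠ o)
    (hiso : ∀ u' : Fin n, u' ≠ o → u' ∉ insert p₁ (insert p₂ Q) → W s(o, u') = 0) (hloop : W s(o, o) = 0)
    (hh₁ : 0 < (W s(o, p₁) : ℝ)) (hh₁' : (W s(o, p₁) : ℝ) < 1) (hh₂ : 0 < (W s(o, p₂) : ℝ)) (hh₂' : (W s(o, p₂) : ℝ) < 1)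
    (hle : (prodBernoulli K).real (openConn p₁ b) ≤ (prodBernoulli K).real (openConn p₂ b))
    (hjb : j ≠ b) (hp₁j : p₁ ≠ j) (hp₂j : p₂ ≠ j) (hjQ : j ∉ Q) (hbA : b ∉ A)
    (hrow₁ : 0 ≤ ∑ S ∈ Q.powerset, ν S *
      ((1 - (u : ℝ)) * ((prodBernoulli (fun e : Sym2 (Fin n) => if (∀ x ∈ e, x ∈ S) ∧ ¬ e.IsDiag then 1 else K e)).real (openConn p₁ b) -
          (prodBernoulli (fun e : Sym2 (Fin n) => if (∀ x ∈ e, x ∈ S) ∧ ¬ e.IsDiag then 1 else K e)).real (openConn j b)) +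
        (u : ℝ) * ((prodBernoulli (fun f : Sym2 (Fin n) => if f = s(p₁, p₂) then 1 else
              (if (∀ x ∈ f, x ∈ S) ∧ ¬ f.IsDiag then 1 else K f))).real (openConn p₁ b) -
          (prodBernoulli (fun f : Sym2 (Fin n) => if f = s(p₁, p₂) then 1 else
              (if (∀ x ∈ f, x ∈ S) ∧ ¬ f.IsDiag then 1 else K f))).real (openConn j b))))
    (hrow₂ : 0 ≤ ∑ S ∈ Q.powerset, ν S *
      ((1 - (u : ℝ)) * ((prodBernoulli (fun e : Sym2 (Fin n) => if (∀ x ∈ e, x ∈ S) ∧ ¬ e.IsDiag then 1 else K e)).real (openConn p₂ b) -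
          (prodBernoulli (fun e : Sym2 (Fin n) => if (∀ x ∈ e, x ∈ S) ∧ ¬ e.IsDiag then 1 else K e)).real (openConn j b)) +
        (u : ℝ) * ((prodBernoulli (fun f : Sym2 (Fin n) => if f = s(p₂, p₁) then 1 else
              (if (∀ x ∈ f, x ∈ S) ∧ ¬ f.IsDiag then 1 else K f))).real (openConn p₂ b) -
          (prodBernoulli (fun f : Sym2 (Fin n) => if f = s(p₂, p₁) then 1 else
              (if (∀ x ∈ f, x ∈ S) ∧ ¬ f.IsDiag then 1 else K f))).real (openConn j b))))
    (hrowQ : ∀ q ∈ Q,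
      (∀ y ∈ Q, (1 - (u : ℝ)) * (prodBernoulli K).real (openConn q b) +
          (u : ℝ) * (prodBernoulli (fun f : Sym2 (Fin n) => if f = s(p₁, p₂) then 1 else K f)).real (openConn q b) ≤
        (1 - (u : ℝ)) * (prodBernoulli K).real (openConn y b) +
          (u : ℝ) * (prodBernoulli (fun f : Sym2 (Fin n) => if f = s(p₁, p₂) then 1 else K f)).real (openConn y b)) →
      (1 - (u : ℝ)) * (prodBernoulli K).real (openConn q b) +
          (u : ℝ) * (prodBernoulli (fun f : Sym2 (Fin n) => if f = s(p₁, p₂) then 1 else K f)).real (openConn q b) ≤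
        (1 - (u : ℝ)) * (prodBernoulli K).real (openConn j b) +
          (u : ℝ) * (prodBernoulli (fun f : Sym2 (Fin n) => if f = s(p₁, p₂) then 1 else K f)).real (openConn j b) →
      0 ≤ ∑ S ∈ Q.powerset, ν S *
        ((1 - (u : ℝ)) * ((prodBernoulli (fun e : Sym2 (Fin n) => if (∀ x ∈ e, x ∈ S) ∧ ¬ e.IsDiag then 1 else K e)).real (openConn q b) -
            (prodBernoulli (fun e : Sym2 (Fin n) => if (∀ x ∈ e, x ∈ S) ∧ ¬ e.IsDiag then 1 else K e)).real (openConn j b)) +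
          (u : ℝ) * ((prodBernoulli (fun f : Sym2 (Fin n) => if f = s(p₁, p₂) then 1 else
                (if (∀ x ∈ f, x ∈ S) ∧ ¬ f.IsDiag then 1 else K f))).real (openConn q b) -
            (prodBernoulli (fun f : Sym2 (Fin n) => if f = s(p₁, p₂) then 1 else
                (if (∀ x ∈ f, x ∈ S) ∧ ¬ f.IsDiag then 1 else K f))).real (openConn j b)))) :
    (prodBernoulli W).real (openConn j b ∩ ⋃ a ∈ A, openConn o a) ≤ (prodBernoulli W).real (openConn o b) := by
  by_cases hQj : ∃ q ∈ Q, (1 - (u : ℝ)) * (prodBernoulli K).real (openConn q b) +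
        (u : ℝ) * (prodBernoulli (fun f : Sym2 (Fin n) => if f = s(p₁, p₂) then 1 else K f)).real (openConn q b) ≤
      (1 - (u : ℝ)) * (prodBernoulli K).real (openConn j b) +
        (u : ℝ) * (prodBernoulli (fun f : Sym2 (Fin n) => if f = s(p₁, p₂) then 1 else K f)).real (openConn j b)
  · -- some `Q`-port is below `j` in `K_u`: the `K_u`-weakest `Q`-port and its row
    obtain ⟨q₀, hq₀Q, hq₀j⟩ := hQj
    obtain ⟨q, hqQ, hqmin⟩ := Finset.exists_min_image Q
      (fun y : Fin n => (1 - (u : ℝ)) * (prodBernoulli K).real (openConn y b) +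
        (u : ℝ) * (prodBernoulli (fun f : Sym2 (Fin n) => if f = s(p₁, p₂) then 1 else K f)).real (openConn y b)) ⟨q₀, hq₀Q⟩
    have hqj := (hqmin q₀ hq₀Q).trans hq₀j
    exact kernel_twoPlusStar_portRow_anchored W A Q o p₁ p₂ q j b K hK u hu ν hν G hG hoA hp₁A hp₂A hQA hp₁Q hp₂Q hbQ hp hjo hbo
      hiso hloop hh₁ hh₁' hh₂ hh₂' hle hjb hp₁j hp₂j hjQ hbA hqj hqmin hrow₁ hrow₂ (hrowQ q hqQ hqmin hqj)
  · -- every `Q`-port is above `j` in `K_u`: `q := j`, whose row vanishes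
    have hqmin : ∀ y ∈ Q, (1 - (u : ℝ)) * (prodBernoulli K).real (openConn j b) +
          (u : ℝ) * (prodBernoulli (fun f : Sym2 (Fin n) => if f = s(p₁, p₂) then 1 else K f)).real (openConn j b) ≤
        (1 - (u : ℝ)) * (prodBernoulli K).real (openConn y b) +
          (u : ℝ) * (prodBernoulli (fun f : Sym2 (Fin n) => if f = s(p₁, p₂) then 1 else K f)).real (openConn y b) :=
      fun y hy => (lt_of_not_ge fun h => hQj ⟨y, hy, h⟩).le
    have hrowj : 0 ≤ ∑ S ∈ Q.powerset, ν S *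
        ((1 - (u : ℝ)) * ((prodBernoulli (fun e : Sym2 (Fin n) => if (∀ x ∈ e, x ∈ S) ∧ ¬ e.IsDiag then 1 else K e)).real (openConn j b) -
            (prodBernoulli (fun e : Sym2 (Fin n) => if (∀ x ∈ e, x ∈ S) ∧ ¬ e.IsDiag then 1 else K e)).real (openConn j b)) +
          (u : ℝ) * ((prodBernoulli (fun f : Sym2 (Fin n) => if f = s(p₁, p₂) then 1 else
                (if (∀ x ∈ f, x ∈ S) ∧ ¬ f.IsDiag then 1 else K f))).real (openConn j b) -
            (prodBernoulli (fun f : Sym2 (Fin n) => if f = s(p₁, p₂) then 1 else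
                (if (∀ x ∈ f, x ∈ S) ∧ ¬ f.IsDiag then 1 else K f))).real (openConn j b))) := by
      simp only [sub_self, mul_zero, add_zero, Finset.sum_const_zero, le_refl]
    exact kernel_twoPlusStar_portRow_anchored W A Q o p₁ p₂ j j b K hK u hu ν hν G hG hoA hp₁A hp₂A hQA hp₁Q hp₂Q hbQ hp hjo hbo
      hiso hloop hh₁ hh₁' hh₂ hh₂' hle hjb hp₁j hp₂j hjQ hbA le_rfl hqmin hrow₁ hrow₂ hrowj

/-- **The `2 + star` kernel, observer level, ONE THEOREM, no ranking hypothesis at all**: as `kernel_twoPlusStar_anchored_of_le` without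
`hle` (the two ports are exchanged when `p₂` is the `K`-weaker one; every input is symmetric in `p₁, p₂`).  Kozma–Nitzan's (41)
`μ_W(j ↔ b, o ↔ A) ≤ μ_W(o ↔ b)` for a one-layer observer with ports `{p₁, p₂} ∪ Q` from the split rows of `p₁`, `p₂` and — only when it is
at most as `b`-reliable as `j` in `K_u` — of a `K_u`-weakest `Q`-port.
[cite: KozmaNitzan2024, Question 9 (p. 36), Question 7 (p. 36), (41) (p. 36), Thm. 4–5 and Lemma 5 (pp. 12–14)] -/
theorem kernel_twoPlusStar_anchored (W : Sym2 (Fin n) → unitInterval) (A Q : Finset (Fin n)) (o p₁ p₂ j b : Fin n)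
    (K : Sym2 (Fin n) → unitInterval) (hK : K = fun e => if o ∈ e then 0 else W e)
    (u : unitInterval) (hu : (u : ℝ) = (W s(o, p₁) : ℝ) * W s(o, p₂))
    (ν : Finset (Fin n) → ℝ) (hν : ∀ Y : Finset (Fin n), ν Y = (∏ q ∈ Y, (W s(o, q) : ℝ)) * ∏ q ∈ Q \ Y, (1 - (W s(o, q) : ℝ)))
    (G : Finset (Fin n) → ℝ)
    (hG : ∀ T : Finset (Fin n), G T =
      (prodBernoulli (fun f : Sym2 (Fin n) => if f ∈ T.image (fun t => s(o, t)) then 1 else K f)).real (openConn o b) -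
        (prodBernoulli (fun f : Sym2 (Fin n) => if f ∈ T.image (fun t => s(o, t)) then 1 else K f)).real (openConn j b))
    (hoA : o ∉ A) (hp₁A : p₁ ∈ A) (hp₂A : p₂ ∈ A) (hQA : Q ⊆ A) (hp₁Q : p₁ ∉ Q) (hp₂Q : p₂ ∉ Q) (hbQ : b ∉ Q) (hp : p₁ ≠ p₂)
    (hjo : j ≠ o) (hbo : b ≠ o)
    (hiso : ∀ u' : Fin n, u' ≠ o → u' ∉ insert p₁ (insert p₂ Q) → W s(o, u') = 0) (hloop : W s(o, o) = 0)
    (hh₁ : 0 < (W s(o, p₁) : ℝ)) (hh₁' : (W s(o, p₁) : ℝ) < 1) (hh₂ : 0 < (W s(o, p₂) : ℝ)) (hh₂' : (W s(o, p₂) : ℝ) < 1)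
    (hjb : j ≠ b) (hp₁j : p₁ ≠ j) (hp₂j : p₂ ≠ j) (hjQ : j ∉ Q) (hbA : b ∉ A)
    (hrow₁ : 0 ≤ ∑ S ∈ Q.powerset, ν S *
      ((1 - (u : ℝ)) * ((prodBernoulli (fun e : Sym2 (Fin n) => if (∀ x ∈ e, x ∈ S) ∧ ¬ e.IsDiag then 1 else K e)).real (openConn p₁ b) -
          (prodBernoulli (fun e : Sym2 (Fin n) => if (∀ x ∈ e, x ∈ S) ∧ ¬ e.IsDiag then 1 else K e)).real (openConn j b)) +
        (u : ℝ) * ((prodBernoulli (fun f : Sym2 (Fin n) => if f = s(p₁, p₂) then 1 else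
              (if (∀ x ∈ f, x ∈ S) ∧ ¬ f.IsDiag then 1 else K f))).real (openConn p₁ b) -
          (prodBernoulli (fun f : Sym2 (Fin n) => if f = s(p₁, p₂) then 1 else
              (if (∀ x ∈ f, x ∈ S) ∧ ¬ f.IsDiag then 1 else K f))).real (openConn j b))))
    (hrow₂ : 0 ≤ ∑ S ∈ Q.powerset, ν S *
      ((1 - (u : ℝ)) * ((prodBernoulli (fun e : Sym2 (Fin n) => if (∀ x ∈ e, x ∈ S) ∧ ¬ e.IsDiag then 1 else K e)).real (openConn p₂ b) -
          (prodBernoulli (fun e : Sym2 (Fin n) => if (∀ x ∈ e, x ∈ S) ∧ ¬ e.IsDiag then 1 else K e)).real (openConn j b)) +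
        (u : ℝ) * ((prodBernoulli (fun f : Sym2 (Fin n) => if f = s(p₂, p₁) then 1 else
              (if (∀ x ∈ f, x ∈ S) ∧ ¬ f.IsDiag then 1 else K f))).real (openConn p₂ b) -
          (prodBernoulli (fun f : Sym2 (Fin n) => if f = s(p₂, p₁) then 1 else
              (if (∀ x ∈ f, x ∈ S) ∧ ¬ f.IsDiag then 1 else K f))).real (openConn j b))))
    (hrowQ : ∀ q ∈ Q,
      (∀ y ∈ Q, (1 - (u : ℝ)) * (prodBernoulli K).real (openConn q b) +
          (u : ℝ) * (prodBernoulli (fun f : Sym2 (Fin n) => if f = s(p₁, p₂) then 1 else K f)).real (openConn q b) ≤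
        (1 - (u : ℝ)) * (prodBernoulli K).real (openConn y b) +
          (u : ℝ) * (prodBernoulli (fun f : Sym2 (Fin n) => if f = s(p₁, p₂) then 1 else K f)).real (openConn y b)) →
      (1 - (u : ℝ)) * (prodBernoulli K).real (openConn q b) +
          (u : ℝ) * (prodBernoulli (fun f : Sym2 (Fin n) => if f = s(p₁, p₂) then 1 else K f)).real (openConn q b) ≤
        (1 - (u : ℝ)) * (prodBernoulli K).real (openConn j b) +
          (u : ℝ) * (prodBernoulli (fun f : Sym2 (Fin n) => if f = s(p₁, p₂) then 1 else K f)).real (openConn j b) →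
      0 ≤ ∑ S ∈ Q.powerset, ν S *
        ((1 - (u : ℝ)) * ((prodBernoulli (fun e : Sym2 (Fin n) => if (∀ x ∈ e, x ∈ S) ∧ ¬ e.IsDiag then 1 else K e)).real (openConn q b) -
            (prodBernoulli (fun e : Sym2 (Fin n) => if (∀ x ∈ e, x ∈ S) ∧ ¬ e.IsDiag then 1 else K e)).real (openConn j b)) +
          (u : ℝ) * ((prodBernoulli (fun f : Sym2 (Fin n) => if f = s(p₁, p₂) then 1 else
                (if (∀ x ∈ f, x ∈ S) ∧ ¬ f.IsDiag then 1 else K f))).real (openConn q b) -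
            (prodBernoulli (fun f : Sym2 (Fin n) => if f = s(p₁, p₂) then 1 else
                (if (∀ x ∈ f, x ∈ S) ∧ ¬ f.IsDiag then 1 else K f))).real (openConn j b)))) :
    (prodBernoulli W).real (openConn j b ∩ ⋃ a ∈ A, openConn o a) ≤ (prodBernoulli W).real (openConn o b) := by
  rcases le_total ((prodBernoulli K).real (openConn p₁ b)) ((prodBernoulli K).real (openConn p₂ b)) with hle | hle
  · exact kernel_twoPlusStar_anchored_of_le W A Q o p₁ p₂ j b K hK u hu ν hν G hG hoA hp₁A hp₂A hQA hp₁Q hp₂Q hbQ hp hjo hbo hiso hloop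
      hh₁ hh₁' hh₂ hh₂' hle hjb hp₁j hp₂j hjQ hbA hrow₁ hrow₂ hrowQ
  · -- exchange the two ports
    have hsw : s(p₂, p₁) = s(p₁, p₂) := Sym2.eq_swap
    have hiso' : ∀ u' : Fin n, u' ≠ o → u' ∉ insert p₂ (insert p₁ Q) → W s(o, u') = 0 :=
      fun u' h1 h2 => hiso u' h1 (by rwa [Finset.insert_comm])
    refine kernel_twoPlusStar_anchored_of_le W A Q o p₂ p₁ j b K hK u (hu.trans (mul_comm _ _)) ν hν G hG hoA hp₂A hp₁A hQA hp₂Q hp₁Q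
      hbQ hp.symm hjo hbo hiso' hloop hh₂ hh₂' hh₁ hh₁' hle hjb hp₂j hp₁j hjQ hbA hrow₂ hrow₁ ?_
    rw [hsw]; exact hrowQ

end UpsetExchange

end

end Summit.CriticalPhenomena.PercolationContinuityZ3.Theorems
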